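import Summits.NavierStokesRegularity.NavierStokesRegularity.Theses.CoriolisHead
import Literature.Analysis.FluidPDE.IsometryInvariance
import Literature.Analysis.FluidPDE.FlatSwirlGauge
import Literature.Analysis.FluidPDE.TsaiSelfSimilarBounded
import HarnessLib

/-!
LANDING NOTE (ns-k2-port-2 g0, firing typer g21's plate sha16 382061e2ed78b9c0 per DIRECTOR-NS #123): the 640-line plate exceeds the
400-line limit for Theorems files with proofs, so it lands as TWO files split at a section boundary with every declaration
byte-identical: THIS file = §0 (skew linear algebra) + §1 (P1 `farField_translationCovariance`); the sequel
`…Theorems.CoriolisHeadFarFieldCovarianceFrame` = §2 scaling + §3 conjugation + §4 (P2′, the Pineau–Vicol frame).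
-/

/-!
# Route CoriolisHead · crux `NoCoRotatingCore` (stmt-NavierStokesRegularity-22676) — line «far-field-constancy»:
# TRANSLATION COVARIANCE (P1) and the PINEAU–VICOL FRAME REDUCTION (P2′) of the rotated Leray profile system

Support file (`--supports stmt-NavierStokesRegularity-22676 --as helper`; theorems only, no definitions, no
named facts), prepared by the typer seat nsreg-typer g21 (cell ns-regularity-ideate) on DIRECTOR-NS g11 #109 for
the line `Cruxes/NoCoRotatingCore/Lines/far_field_constancy.lean` of ns-idea-10 g0 (skeleton dfea78de5840;
critic idea-crit-8 PASS-WITH-PRICE 2026-08-28T02:56Z).  The line's skeleton has `sorry`d stubs and is not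
importable, so the two statements below are RESTATED VERBATIM (binders, order, spelling) from it.

THE SYSTEM (Pineau–Vicol (1.8a) with `αJ ↦ B`, any `ν, a > 0`, any skew `B`):
`−νΔU + aU + a(y·∇)U + (BU − (By·∇)U) + (U·∇)U + ∇P = 0`, `div U = 0` on `ℝ³`.

* `farField_translationCovariance` = the line's stub **`stub_translationCovariance` (P1) VERBATIM, PROVED**:
  if `‖U y − b‖ ≤ K/(1+‖y‖)` then for the (unique) `y₀` with `a y₀ − B y₀ = −b` the recentred field
  `y ↦ U (y + y₀) − b` solves the same system with pressure `y ↦ P (y + y₀) + ⟪a b + B b, y⟫` and decays like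
  `K(1+‖y₀‖)/(1+‖y‖)`.  (`⟨(aI − B)y, y⟩ = a‖y‖²` gives injectivity hence surjectivity of `aI − B`; the extra
  terms are `ab + Bb = ∇⟪ab + Bb, ·⟫` and `DŨ[a y₀ − B y₀ + b] = 0`; `1+‖y‖ ≤ (1+‖y₀‖)(1+‖y+y₀‖)`.)
* `decayingRotatedLiouville_of_pineauVicolFrame` = the critic's price **P2′**: the line's residual
  `stub_decayingRotatedLiouville` (R1: decaying smooth rotated profiles vanish, EVERY `ν, a > 0`, EVERY skew `B`)
  FOLLOWS from Pineau–Vicol's Conjecture 1.1 AS PRINTED — profile form, frame `(ν, a, B) = (1, ½, αJ)`,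
  `J = R′(0)` the generator of the rotations about `e₃` ((1.6); tree `Literature.Analysis.FluidPDE.rotGenL`),
  `α ≠ 0`: «let `α ≠ 0` and `U` a smooth solution of (1.8) on `ℝ³`; if `|U(y)| ≤ C/(1+|y|)` then `U ≡ 0`»
  [arXiv:2607.09619 p. 3, (1.8a) `α(JU − (Jy·∇)U) + ½U + ½(y·∇)U − ΔU + (U·∇)U + ∇P = 0`, (1.8b) `∇·U = 0`].
  Proof: parabolic scaling `W(z) = cU(λz)`, `Q(z) = c²P(λz)`, `λ = √(ν/2a)`, `c = 1/(2aλ)` takes `(ν, a, B)` to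
  `(1, ½, B/2a)`; a real skew `B′` on `ℝ³` has a kernel vector (`det B′ = det(−B′ᵀ) = −det B′`), and in an
  orthonormal basis `(f₁, f₂, e)` with `B′e = 0` one has `B′f₁ = αf₂`, `B′f₂ = −αf₁`, so the isometry
  `R : fᵢ ↦ eᵢ` conjugates `B′` to `αJ`; the system is covariant under `U ↦ R ∘ U ∘ R⁻¹`, `P ↦ P ∘ R⁻¹`
  (tree `IsometryInvariance`: `fderiv/convect/divergence/gradient/laplacian_conj_linearIsometryEquiv`); the
  case `α = 0` (i.e. `B = 0`) is Tsai's theorem in the tree (`IsLerayProfile.exists_eq_const_of_bounded` +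
  decay).  With the converse `pineauVicolFrame_of_decayingRotatedLiouville` (instantiate `ν = 1, a = ½,
  B = αJ`): **R1 ⟺ Conjecture 1.1 as printed** (`decayingRotatedLiouville_iff_pineauVicolFrame`), so the
  line's residual is exactly the printed open problem, not a strengthening of it.

HONEST FRAMING.  Nothing here proves `stub_farFieldConstancy` (K1, the line's crux), `NoCoRotatingCore`,
Pineau–Vicol's Conjecture 1.1, or Navier–Stokes regularity: these are bookkeeping lemmas (change of origin,
of scale and of axes) of a REDUCTION of one crux to a printed conjecture.  WHAT THIS IS NOT: not 22676, not K1,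
NOT NS regularity.  bears_on: stmt-NavierStokesRegularity-22676 (line far-field-constancy: P1, P2′).

References: B. Pineau, V. Vicol, arXiv:2607.09619 (2026), (1.6)–(1.9), Conjecture 1.1 [PineauVicol2026];
T.-P. Tsai, ARMA 143 (1998), Thm 1 [Tsai1998]; A. Majda, A. Bertozzi, *Vorticity and Incompressible Flow*
(CUP 2002), §1.2 Prop. 1.1 (symmetry groups) [MajdaBertozziCUP2002].
-/

noncomputable section

-- the summit and its single sub-problem share the name (CONVENTIONS §1), as in every Theorems file
set_option linter.dupNamespace false

open Set Function Module
open scoped RealInnerProductSpace Laplacian ContDiff BigOperators InnerProductSpace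
open Literature.Analysis.FluidPDE

namespace Summit.NavierStokesRegularity.NavierStokesRegularity.Theorems.CoriolisHead

/-! ### §0 Linear algebra of a skew operator on `ℝ³` -/

section Skew

variable {B : EuclideanSpace ℝ (Fin 3) →L[ℝ] EuclideanSpace ℝ (Fin 3)}

/-- Polarisation of `⟪Bx, x⟫ = 0`: `⟪Bx, y⟫ = −⟪By, x⟫`. [folklore] -/
theorem inner_skew_swap (hB : ∀ x, inner ℝ (B x) x = 0) (x y : EuclideanSpace ℝ (Fin 3)) :
    ⟪B x, y⟫ = -⟪B y, x⟫ := by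
  have h := hB (x + y)
  rw [map_add, inner_add_left, inner_add_right, inner_add_right, hB x, hB y] at h
  linarith

/-- `⟪x, By⟫ = −⟪y, Bx⟫` (the same, arguments flipped). [folklore] -/
theorem inner_skew_swap' (hB : ∀ x, inner ℝ (B x) x = 0) (x y : EuclideanSpace ℝ (Fin 3)) :
    ⟪x, B y⟫ = -⟪y, B x⟫ := by
  have h1 := inner_skew_swap hB y x
  have h2 : ⟪x, B y⟫ = ⟪B y, x⟫ := real_inner_comm _ _
  have h3 : ⟪y, B x⟫ = ⟪B x, y⟫ := real_inner_comm _ _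
  linarith

/-- `a • id − B` is onto for `a ≠ 0` and `B` skew: `⟪(a − B)y, y⟫ = a‖y‖²` gives injectivity, and an
injective endomorphism of a finite-dimensional space is surjective. [folklore] -/
theorem exists_recentre (hB : ∀ x, inner ℝ (B x) x = 0) {a : ℝ} (ha : a ≠ 0)
    (v : EuclideanSpace ℝ (Fin 3)) : ∃ y₀ : EuclideanSpace ℝ (Fin 3), a • y₀ - B y₀ = v := by
  set L : EuclideanSpace ℝ (Fin 3) →ₗ[ℝ] EuclideanSpace ℝ (Fin 3) :=
    a • LinearMap.id - B.toLinearMap with hL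
  have hLapply : ∀ y, L y = a • y - B y := fun y => by simp [hL]
  have hinj : Function.Injective L := by
    intro y z hyz
    have h0 : L (y - z) = 0 := by rw [map_sub, hyz, sub_self]
    have key : ⟪L (y - z), y - z⟫ = a * ‖y - z‖ ^ 2 := by
      rw [hLapply, inner_sub_left, inner_smul_left, hB (y - z), real_inner_self_eq_norm_sq]
      simp
    rw [h0, inner_zero_left] at key
    have hn : ‖y - z‖ ^ 2 = 0 := by
      rcases mul_eq_zero.1 key.symm with h | h
      · exact absurd h ha
      · exact h
    exact sub_eq_zero.1 (norm_eq_zero.1 (pow_eq_zero_iff two_ne_zero |>.1 hn))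
  obtain ⟨y₀, hy₀⟩ := (LinearMap.injective_iff_surjective.1 hinj) v
  exact ⟨y₀, by rw [← hLapply, hy₀]⟩

/-- A real skew operator on `ℝ³` has a non-trivial kernel (`det B = det Bᵀ = det(−B) = −det B`). [folklore] -/
theorem exists_ne_zero_map_eq_zero_of_skew (hB : ∀ x, inner ℝ (B x) x = 0) :
    ∃ e : EuclideanSpace ℝ (Fin 3), e ≠ 0 ∧ B e = 0 := by
  classical
  set b := stdOrthonormalBasis ℝ (EuclideanSpace ℝ (Fin 3)) with hb_def
  set Bl : EuclideanSpace ℝ (Fin 3) →ₗ[ℝ] EuclideanSpace ℝ (Fin 3) := B.toLinearMap with hBl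
  set M : Matrix _ _ ℝ := LinearMap.toMatrix b.toBasis b.toBasis Bl with hM
  -- the matrix of `B` in an orthonormal basis is antisymmetric
  have hMij : ∀ i j, M i j = ⟪b i, B (b j)⟫ := by
    intro i j
    rw [hM, LinearMap.toMatrix_apply, OrthonormalBasis.coe_toBasis_repr_apply,
      OrthonormalBasis.repr_apply_apply, OrthonormalBasis.coe_toBasis]
    rfl
  have hMt : Matrix.transpose M = -M := by
    ext i j
    rw [Matrix.transpose_apply, Matrix.neg_apply, hMij, hMij]
    exact inner_skew_swap' hB (b j) (b i)
  have hdetM : M.det = 0 := by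
    have h1 : M.det = (-M).det := by rw [← hMt, Matrix.det_transpose]
    rw [Matrix.det_neg, Fintype.card_fin] at h1
    norm_num at h1
    linarith
  have hdet : LinearMap.det Bl = 0 := by
    rw [← LinearMap.det_toMatrix b.toBasis, ← hM]; exact hdetM
  have hker : ⊥ < LinearMap.ker Bl := LinearMap.bot_lt_ker_of_det_eq_zero hdet
  obtain ⟨e, he, hne⟩ := (Submodule.ne_bot_iff _).1 (bot_lt_iff_ne_bot.1 hker)
  refine ⟨e, hne, ?_⟩
  have h := LinearMap.mem_ker.1 he
  simpa [hBl] using h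

/-- **Skew normal form on `ℝ³`.** For a skew `B` there are a linear isometry `R` of `ℝ³` and `α ∈ ℝ` with
`R B R⁻¹ = α J`, `J = rotGen` the generator of the rotations about `e₃` (choose an orthonormal basis
`(f₁, f₂, e)` with `Be = 0`; then `Bf₁ = αf₂`, `Bf₂ = −αf₁`, and `R : fᵢ ↦ eᵢ`); moreover `α = 0` forces
`B = 0`. [folklore] -/
theorem exists_linearIsometryEquiv_conj_eq_rotGen (hB : ∀ x, inner ℝ (B x) x = 0) :
    ∃ (R : EuclideanSpace ℝ (Fin 3) ≃ₗᵢ[ℝ] EuclideanSpace ℝ (Fin 3)) (α : ℝ),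
      (∀ y, R (B (R.symm y)) = α • rotGen y) ∧ (α = 0 → B = 0) := by
  classical
  obtain ⟨e₀, he₀, hBe₀⟩ := exists_ne_zero_map_eq_zero_of_skew hB
  -- a unit kernel vector
  set e : EuclideanSpace ℝ (Fin 3) := ‖e₀‖⁻¹ • e₀ with he_def
  have hne : ‖e₀‖ ≠ 0 := norm_ne_zero_iff.2 he₀
  have he1 : ‖e‖ = 1 := by
    rw [he_def, norm_smul, norm_inv, norm_norm, inv_mul_cancel₀ hne]
  have hBe : B e = 0 := by rw [he_def, map_smul, hBe₀, smul_zero]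
  -- an orthonormal basis `c` with `c 2 = e`
  set v : Fin 3 → EuclideanSpace ℝ (Fin 3) := fun _ => e with hv
  have hvo : Orthonormal ℝ (({2} : Set (Fin 3)).restrict v) := by
    refine ⟨fun i => by simp [hv, he1], ?_⟩
    intro i j hij
    exfalso
    apply hij
    apply Subtype.ext
    rw [Set.mem_singleton_iff.1 i.2, Set.mem_singleton_iff.1 j.2]
  obtain ⟨c, hc⟩ := hvo.exists_orthonormalBasis_extension_of_card_eq (by simp)
  have hc2 : c 2 = e := hc 2 rfl
  -- structure constants
  have hB2 : B (c 2) = 0 := by rw [hc2, hBe]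
  have hexp : ∀ w : EuclideanSpace ℝ (Fin 3), w = ∑ i, ⟪c i, w⟫ • c i := fun w =>
    (c.sum_repr' w).symm
  have hperp2 : ∀ w, ⟪c 2, B w⟫ = 0 := fun w => by
    rw [inner_skew_swap' hB, hB2, inner_zero_right, neg_zero]
  have hself : ∀ w, ⟪w, B w⟫ = 0 := fun w => by
    rw [real_inner_comm]; exact hB w
  set α : ℝ := ⟪c 1, B (c 0)⟫ with hα
  have hB0 : B (c 0) = α • c 1 := by
    rw [hexp (B (c 0)), Fin.sum_univ_three, hself, hperp2, zero_smul, zero_smul, zero_add, add_zero]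
  have hB1 : B (c 1) = (-α) • c 0 := by
    have h01 : ⟪c 0, B (c 1)⟫ = -α := by rw [hα, inner_skew_swap' hB]
    rw [hexp (B (c 1)), Fin.sum_univ_three, hself, h01, hperp2, zero_smul, zero_smul, add_zero, add_zero]
  -- the isometry `R = c.repr : fᵢ ↦ eᵢ`
  refine ⟨c.repr, α, fun y => ?_, fun hα0 => ?_⟩
  · rw [← c.sum_repr_symm y]
    simp only [Fin.sum_univ_three, map_add, map_smul, hB0, hB1, hB2, smul_zero, add_zero,
      c.repr_self]
    ext j
    fin_cases j <;> simp [rotGen] <;> ring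
  · -- `α = 0 ⇒ B = 0`
    have h0 : ∀ i, B (c i) = 0 := by
      intro i
      fin_cases i
      · simpa [hα0] using hB0
      · simpa [hα0] using hB1
      · exact hB2
    have hBb : ∀ w, B w = 0 := fun w => by
      rw [hexp w, map_sum]
      simp [map_smul, h0]
    ext w i
    simp [hBb w]

end Skew

/-! ### §1 Translation covariance — the line's stub `stub_translationCovariance` (P1), VERBATIM -/

section Translation

/-- `1 + ‖y‖ ≤ (1 + ‖y₀‖)(1 + ‖y + y₀‖)`. [folklore] -/
theorem one_add_norm_le_mul (y y₀ : EuclideanSpace ℝ (Fin 3)) :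
    1 + ‖y‖ ≤ (1 + ‖y₀‖) * (1 + ‖y + y₀‖) := by
  have h1 : ‖y‖ ≤ ‖y + y₀‖ + ‖y₀‖ := by
    calc ‖y‖ = ‖(y + y₀) - y₀‖ := by rw [add_sub_cancel_right]
      _ ≤ ‖y + y₀‖ + ‖y₀‖ := norm_sub_le _ _
  nlinarith [norm_nonneg y₀, norm_nonneg (y + y₀)]

/-- The gradient of `y ↦ P (y + y₀) + ⟪c, y⟫` is `∇P(y + y₀) + c` (for `P ∈ C¹`). [folklore] -/
theorem gradient_translate_add_inner {P : EuclideanSpace ℝ (Fin 3) → ℝ} (hP : ContDiff ℝ 1 P)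
    (y₀ c y : EuclideanSpace ℝ (Fin 3)) :
    gradient (fun w => P (w + y₀) + ⟪c, w⟫) y = gradient P (y + y₀) + c := by
  have hd1 : DifferentiableAt ℝ (fun w => P (w + y₀)) y :=
    ((hP.differentiable one_ne_zero).comp (differentiable_id.add (differentiable_const _))) y
  have hfun : (fun w : EuclideanSpace ℝ (Fin 3) => ⟪c, w⟫) = innerSL ℝ c := by
    funext w; simp
  have hd2 : DifferentiableAt ℝ (fun w : EuclideanSpace ℝ (Fin 3) => ⟪c, w⟫) y := by
    rw [hfun]; exact (innerSL ℝ c).differentiableAt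
  unfold gradient
  rw [fderiv_fun_add hd1 hd2, map_add, fderiv_comp_add_right, hfun, ContinuousLinearMap.fderiv]
  congr 1
  apply (InnerProductSpace.toDual ℝ (EuclideanSpace ℝ (Fin 3))).injective
  rw [LinearIsometryEquiv.apply_symm_apply]
  ext w
  simp [InnerProductSpace.toDual_apply_apply]

/-- **P1 — translation covariance of the rotated Leray profile system** (the line's stub
`stub_translationCovariance`, statement VERBATIM).  If `‖U y − b‖ ≤ K/(1+‖y‖)` then for the (unique) `y₀`
with `a y₀ − B y₀ = −b` the field `y ↦ U (y + y₀) − b` solves the same system with pressure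
`y ↦ P (y + y₀) + ⟪a b + B b, y⟫` and decays like `K(1+‖y₀‖)/(1+‖y‖)`: recentring the profile system adds
the constant `ab + Bb` (a gradient) and the drift term `DŨ[a y₀ − B y₀ + b] = 0`.
[cite: PineauVicol2026, (1.8) (arXiv:2607.09619 p. 3); folklore bookkeeping] -/
theorem farField_translationCovariance :
    ∀ (ν a : ℝ), 0 < ν → 0 < a →
      ∀ (B : EuclideanSpace ℝ (Fin 3) →L[ℝ] EuclideanSpace ℝ (Fin 3))
        (U : EuclideanSpace ℝ (Fin 3) → EuclideanSpace ℝ (Fin 3)) (P : EuclideanSpace ℝ (Fin 3) → ℝ),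
      ContDiff ℝ (⊤ : ℕ∞) U → ContDiff ℝ 2 P → (∀ x, inner ℝ (B x) x = 0) →
      Literature.Analysis.FluidPDE.VectorCalculus.IsDivFree U →
      (∀ y, -(ν • Laplacian.laplacian U y) + a • U y + a • fderiv ℝ U y y
        + (B (U y) - fderiv ℝ U y (B y)) + Literature.Analysis.FluidPDE.convect U U y
        + gradient P y = 0) →
      ∀ (b : EuclideanSpace ℝ (Fin 3)) (K : ℝ), (∀ y, ‖U y - b‖ ≤ K / (1 + ‖y‖)) →
      ∃ (y₀ : EuclideanSpace ℝ (Fin 3)) (P' : EuclideanSpace ℝ (Fin 3) → ℝ) (K' : ℝ),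
        a • y₀ - B y₀ = -b ∧
        ContDiff ℝ (⊤ : ℕ∞) (fun y => U (y + y₀) - b) ∧ ContDiff ℝ 2 P' ∧
        Literature.Analysis.FluidPDE.VectorCalculus.IsDivFree (fun y => U (y + y₀) - b) ∧
        (∀ y, -(ν • Laplacian.laplacian (fun y => U (y + y₀) - b) y) + a • (fun y => U (y + y₀) - b) y
          + a • fderiv ℝ (fun y => U (y + y₀) - b) y y
          + (B ((fun y => U (y + y₀) - b) y) - fderiv ℝ (fun y => U (y + y₀) - b) y (B y))
          + Literature.Analysis.FluidPDE.convect (fun y => U (y + y₀) - b) (fun y => U (y + y₀) - b) y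
          + gradient P' y = 0) ∧
        (∀ y, ‖(fun y => U (y + y₀) - b) y‖ ≤ K' / (1 + ‖y‖)) := by
  intro ν a hν ha B U P hU hP hB hdiv heq b K hdec
  obtain ⟨y₀, hy₀⟩ := exists_recentre hB ha.ne' (-b)
  refine ⟨y₀, fun w => P (w + y₀) + ⟪a • b + B b, w⟫, K * (1 + ‖y₀‖), hy₀, ?_, ?_, ?_, ?_, ?_⟩
  · exact (hU.comp (contDiff_id.add contDiff_const)).sub contDiff_const
  · exact (hP.comp (contDiff_id.add contDiff_const)).add (contDiff_const.inner ℝ contDiff_id)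
  · intro y
    unfold VectorCalculus.divergence
    rw [fderiv_sub_const, fderiv_comp_add_right]
    exact hdiv (y + y₀)
  · intro y
    -- the terms of the recentred system in terms of `U` at `z = y + y₀`
    have hUs : ContDiff ℝ 2 U := hU.of_le (by norm_cast)
    have hΔ : Laplacian.laplacian (fun y => U (y + y₀) - b) y = Laplacian.laplacian U (y + y₀) := by
      have hsplit : (fun y => U (y + y₀) - b) = (fun y => U (y + y₀)) - fun _ => b := by
        funext w; simp
      have h1 : ContDiffAt ℝ 2 (fun y => U (y + y₀)) y :=
        (hUs.comp (contDiff_id.add contDiff_const)).contDiffAt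
      have h2 : ContDiffAt ℝ 2 (fun _ : EuclideanSpace ℝ (Fin 3) => b) y := contDiffAt_const
      rw [hsplit, h1.laplacian_sub h2, laplacian_comp_add_const]
      simp
    have hfd : fderiv ℝ (fun y => U (y + y₀) - b) y = fderiv ℝ U (y + y₀) := by
      rw [fderiv_sub_const, fderiv_comp_add_right]
    have hgr : gradient (fun w => P (w + y₀) + ⟪a • b + B b, w⟫) y = gradient P (y + y₀) + (a • b + B b) :=
      gradient_translate_add_inner (hP.of_le (by norm_num)) y₀ (a • b + B b) y
    rw [hΔ, convect_apply, hfd, hgr]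
    have key : -(ν • Laplacian.laplacian U (y + y₀)) + a • (U (y + y₀) - b)
        + a • fderiv ℝ U (y + y₀) y
        + (B (U (y + y₀) - b) - fderiv ℝ U (y + y₀) (B y))
        + fderiv ℝ U (y + y₀) (U (y + y₀) - b) + (gradient P (y + y₀) + (a • b + B b))
        = (-(ν • Laplacian.laplacian U (y + y₀)) + a • U (y + y₀) + a • fderiv ℝ U (y + y₀) (y + y₀)
          + (B (U (y + y₀)) - fderiv ℝ U (y + y₀) (B (y + y₀)))
          + Literature.Analysis.FluidPDE.convect U U (y + y₀) + gradient P (y + y₀))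
          - fderiv ℝ U (y + y₀) (a • y₀ - B y₀ + b) := by
      simp only [convect_apply, map_add, map_sub, map_smul, smul_sub, smul_add]
      abel
    rw [key, heq (y + y₀), hy₀, neg_add_cancel, map_zero, sub_zero]
  · intro y
    have hK : 0 ≤ K := by
      have h := hdec 0
      rw [norm_zero, add_zero, div_one] at h
      exact (norm_nonneg _).trans h
    have hpos : 0 < 1 + ‖y‖ := by positivity
    calc ‖U (y + y₀) - b‖ ≤ K / (1 + ‖y + y₀‖) := hdec (y + y₀)
      _ = K * (1 + ‖y₀‖) / ((1 + ‖y₀‖) * (1 + ‖y + y₀‖)) := by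
          rw [mul_comm K (1 + ‖y₀‖), mul_div_mul_left _ _ (by positivity : (1 + ‖y₀‖) ≠ 0)]
      _ ≤ K * (1 + ‖y₀‖) / (1 + ‖y‖) :=
          div_le_div_of_nonneg_left (by positivity) hpos (one_add_norm_le_mul y y₀)

end Translation

end Summit.NavierStokesRegularity.NavierStokesRegularity.Theorems.CoriolisHead

end
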